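import Literature.Probability.LatticeModels.TorusGreenHessianDecay
import HarnessLib

/-!
# Route `UnitScaleTilt`, crux K1 «MinimiserStabilityRegPr» (stmt-QuantumFields-19200), route-R E′ path (α′), residue (hK), sub-row (N): BRICKS FOR THE GRADIENT DECAY OF THE
# TORUS GREEN FUNCTION IN `d = 3` — the `d = 3`, first-difference siblings of the `d = 4` Hessian letters of ✓ `Literature.Probability.LatticeModels.TorusGreenHessianDecay`:
# the product-kernel gradient identity, its heat-kernel bound `|∇ᵢ[∏_μ q^L_s](z)| ≤ K·(1∨s)·((1∨s) + z̃_{μ₀}²)⁻³`, and the time integral `∫₀^S ((s+c)²)⁻¹ ≤ c⁻¹`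

Cell `ym3-torus`, D-0154 (3c) twin-width seat `ym-routeR-w3` (gen 5); ★p1 g14 17:33:03Z∕17:53:40Z «hInterp part (B)», standing PASS-at-dry-run 18:44:59Z; LOCATE 19200 evidence #53 §7∕§8.
WHY: (N)'s one missing analytic input is the Newtonian size∕gradient decay of the torus Green function, uniform in the period; the tree's heat-kernel chain `SRWHeatKernel1D →
… → TorusGreenHeatKernel → TorusGreenHessianDecay` proves the `d = 4` HESSIAN decay; the `d = 3` GRADIENT decay `|∇ᵢG̃_L(z)|·dist² ≤ C` is its sibling (one difference factor
`(1∨s)⁻¹`, two plain factors `(1∨s)^{−1∕2}`, weight `(1 + z̃²∕(1∨s))⁻³` ⇒ `(1∨s)((1∨s)+z̃²)⁻³ ≤ ((1∨s)+z̃²)⁻²`, time integral `≤ z̃⁻²`; Fourier tail `O(L^{1−d}) = O(L⁻²)`).  This file lands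
the three `s`-local bricks; the representation `∇ᵢG̃ = ∫₀^S ∇ᵢ[∏q] ds + tail`, the tail bound and the assembly are the next seat's (same template, ✓ `torusGreen_hessian_eq`,
✓ `abs_torusGreen_hessian_tail_le`).  THEOREMS ONLY (0 `def`, 0 `sorry`); `--supports stmt-QuantumFields-19200`, count-neutral.  YM₃ on T³ is a ladder rung (R3), not the Clay problem;
nothing here claims the stub, the crux, d = 4 or the gap.

WHAT IS PROVED (ns `…Theorems.Prop7TorusGreenGradientBricks`; carrier `TorusSite d L = Fin d → ZMod L`, `torusHeatKernel` of ✓ `TorusHeatKernel1D`).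
* `grad_prod` — `∏_μ q((z+eᵢ)_μ) − ∏_μ q(z_μ) = (q(zᵢ+1) − q(zᵢ))·∏_{μ≠i} q(z_μ)` (any `d`).
* `prod_le_apply_of_le_one'` — a product of numbers in `[0,1]` is at most any factor.
* ★★ `abs_grad_prod_torusHeatKernel_le` — `d = 3`: `∃ K > 0, ∀ L s (0 < s ≤ L²) z i μ₀, |∇ᵢ[∏_μ q^L_s](z)| ≤ K·(1∨s)·(((1∨s) + z̃_{μ₀}²)³)⁻¹`.
* `integral_inv_add_sq_le` — `∫₀^S ((s+c)²)⁻¹ ds ≤ c⁻¹` (`c > 0`, `S ≥ 0`).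
HONEST SCOPE.  Bricks only; no Green-function statement is proved here.

References: G. F. Lawler, V. Limic, *Random Walk: A Modern Introduction*, CUP 2010, Thm 4.3.1, §6.3 [LawlerLimic2010]; G. F. Lawler, *Intersections of Random Walks* (1991),
Thm 1.5.4–1.5.5 (orientation); T. Bałaban, CMP 99 (1985) 75–102 [Balaban1985RegularSpaces] ((1.36) p.82).
-/

set_option autoImplicit false

noncomputable section

open MeasureTheory Set Finset ZMod intervalIntegral
open scoped Real BigOperators

namespace Summit.QuantumFields.YangMills.Theorems.Prop7TorusGreenGradientBricks

open Literature.Probability.LatticeModels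

variable {d L : ℕ}

/-- **The first difference of a product kernel**: `∏_μ q((z+eᵢ)_μ) − ∏_μ q(z_μ) = (q(zᵢ+1) − q(zᵢ))·∏_{μ≠i} q(z_μ)`. [folklore] -/
theorem grad_prod (q : ZMod L → ℝ) (z : TorusSite d L) (i : Fin d) :
    (∏ μ, q ((z + Pi.single i 1 : TorusSite d L) μ)) - ∏ μ, q (z μ)
      = (q (z i + 1) - q (z i)) * ∏ μ ∈ (univ : Finset (Fin d)).erase i, q (z μ) := by
  set zA : TorusSite d L := z + Pi.single i 1 with hzA
  have hE : ∀ μ ∈ (univ : Finset (Fin d)).erase i, μ ≠ i := fun μ hμ => Finset.ne_of_mem_erase hμ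
  have hAi : zA i = z i + 1 := by simp [hzA]
  have hA : ∏ μ ∈ (univ : Finset (Fin d)).erase i, q (zA μ) = ∏ μ ∈ (univ : Finset (Fin d)).erase i, q (z μ) :=
    Finset.prod_congr rfl fun μ hμ => by simp [hzA, Pi.single_eq_of_ne (hE μ hμ)]
  rw [← Finset.mul_prod_erase _ (fun μ => q (zA μ)) (Finset.mem_univ i),
    ← Finset.mul_prod_erase _ (fun μ => q (z μ)) (Finset.mem_univ i), hA, hAi]
  ring

/-- a product of numbers in `[0, 1]` is at most any one of its factors. [folklore] -/
theorem prod_le_apply_of_le_one' {W : Fin d → ℝ} (h0 : ∀ μ, 0 ≤ W μ) (h1 : ∀ μ, W μ ≤ 1) (μ₀ : Fin d) :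
    ∏ μ, W μ ≤ W μ₀ := by
  rw [← Finset.mul_prod_erase _ _ (Finset.mem_univ μ₀)]
  exact mul_le_of_le_one_right (h0 μ₀) (Finset.prod_le_one (fun μ _ => h0 μ) fun μ _ => h1 μ)

/-- ★★ **Bound on the GRADIENT of the product heat kernel of `(ℤ/Lℤ)³`**: there is `K > 0` such that for all `L ≥ 1`, `0 < s ≤ L²`, `z`, `i` and every coordinate `μ₀`,
`|∏_μ q^L_s((z+eᵢ)_μ) − ∏_μ q^L_s(z_μ)| ≤ K·(1∨s)·(((1∨s) + z̃_{μ₀}²)³)⁻¹`: the difference factor gives `(1∨s)⁻¹`, the two plain factors `(1∨s)^{−1∕2}` each, and every factor a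
Gaussian weight `≤ 1`, of which the one at `μ₀` is kept (`(1∨s)⁻²(1 + z̃²∕(1∨s))⁻³ = (1∨s)((1∨s)+z̃²)⁻³`). [folklore] -/
theorem abs_grad_prod_torusHeatKernel_le : ∃ K : ℝ, 0 < K ∧ ∀ (L : ℕ) [NeZero L] (s : ℝ),
    0 < s → s ≤ (L : ℝ) ^ 2 → ∀ (z : TorusSite 3 L) (i μ₀ : Fin 3),
      |(∏ μ, torusHeatKernel s ((z + Pi.single i 1 : TorusSite 3 L) μ)) - ∏ μ, torusHeatKernel s (z μ)|
        ≤ K * (max 1 s) * (((max 1 s) + ((z μ₀).valMinAbs : ℝ) ^ 2) ^ 3)⁻¹ := by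
  obtain ⟨K₀, hK₀, h₀⟩ := abs_torusHeatKernel_le
  obtain ⟨K₁, hK₁, h₁⟩ := abs_torusHeatKernel_fwdDiff_le
  set K : ℝ := max K₀ K₁ with hK
  have hK0 : K₀ ≤ K := le_max_left _ _
  have hK1 : K₁ ≤ K := le_max_right _ _
  have hKpos : 0 < K := hK₀.trans_le hK0
  refine ⟨K ^ 3, by positivity, ?_⟩
  intro L _ s hs hsL z i μ₀
  set T : ℝ := max 1 s with hT
  have hT1 : 1 ≤ T := le_max_left _ _
  have hT0 : 0 < T := by positivity
  set σ : ℝ := T ^ (-(1 / 2 : ℝ)) with hσ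
  have hσ0 : 0 < σ := Real.rpow_pos_of_pos hT0 _
  have hσσ : σ * σ = T⁻¹ := max_one_rpow_neg_half_mul_self s
  -- the Gaussian weights
  set W : Fin 3 → ℝ := fun μ => ((1 + ((z μ).valMinAbs : ℝ) ^ 2 / T) ^ 3)⁻¹ with hW
  have hW0 : ∀ μ, 0 ≤ W μ := fun μ => by positivity
  have hW1 : ∀ μ, W μ ≤ 1 := fun μ => by
    rw [hW]
    exact inv_le_one_of_one_le₀ (one_le_pow₀ (by
      have : 0 ≤ ((z μ).valMinAbs : ℝ) ^ 2 / T := by positivity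
      linarith))
  have hWμ₀ : ∏ μ, W μ ≤ W μ₀ := prod_le_apply_of_le_one' hW0 hW1 μ₀
  have b₀ : ∀ m : ZMod L, |torusHeatKernel s m| ≤ K * σ * ((1 + (m.valMinAbs : ℝ) ^ 2 / T) ^ 3)⁻¹ := fun m =>
    (h₀ L s hs hsL m).trans (by gcongr)
  have b₁ : ∀ m : ZMod L, |torusHeatKernel s (m + 1) - torusHeatKernel s m| ≤ K * T⁻¹ * ((1 + (m.valMinAbs : ℝ) ^ 2 / T) ^ 3)⁻¹ := fun m =>
    (h₁ L s hs hsL m).trans (by gcongr)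
  -- the target weight: `K³·T⁻²·W μ₀ = K³·T·((T + z̃²)³)⁻¹`
  have htarget : K ^ 3 * T⁻¹ ^ 2 * W μ₀ = K ^ 3 * T * ((T + ((z μ₀).valMinAbs : ℝ) ^ 2) ^ 3)⁻¹ := by
    rw [hW]
    have hTne : T ≠ 0 := hT0.ne'
    field_simp
  rw [← htarget]
  rw [grad_prod (fun m => torusHeatKernel s m) z i, abs_mul, Finset.abs_prod]
  have hcard : ((univ : Finset (Fin 3)).erase i).card = 2 := by
    rw [Finset.card_erase_of_mem (Finset.mem_univ i), Finset.card_univ, Fintype.card_fin]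
  have hrest : ∏ μ ∈ (univ : Finset (Fin 3)).erase i, |torusHeatKernel s (z μ)| ≤ ∏ μ ∈ (univ : Finset (Fin 3)).erase i, (K * σ * W μ) :=
    Finset.prod_le_prod (fun μ _ => abs_nonneg _) fun μ _ => b₀ (z μ)
  calc |torusHeatKernel s (z i + 1) - torusHeatKernel s (z i)| * ∏ μ ∈ (univ : Finset (Fin 3)).erase i, |torusHeatKernel s (z μ)|
      ≤ (K * T⁻¹ * W i) * ∏ μ ∈ (univ : Finset (Fin 3)).erase i, (K * σ * W μ) :=
        mul_le_mul (b₁ (z i)) hrest (Finset.prod_nonneg fun μ _ => abs_nonneg _) (by positivity)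
    _ = K ^ 3 * (T⁻¹ * (σ * σ)) * (W i * ∏ μ ∈ (univ : Finset (Fin 3)).erase i, W μ) := by
        rw [Finset.prod_mul_distrib, Finset.prod_const, hcard]
        ring
    _ = K ^ 3 * T⁻¹ ^ 2 * ∏ μ, W μ := by
        rw [hσσ, Finset.mul_prod_erase _ _ (Finset.mem_univ i)]
        ring
    _ ≤ K ^ 3 * T⁻¹ ^ 2 * W μ₀ := by gcongr

/-- **`∫₀^S ((s + c)²)⁻¹ ds ≤ c⁻¹`** for `c > 0`, `S ≥ 0` (the time integral of the gradient bound, after `(1∨s)((1∨s)+c)⁻³ ≤ ((1∨s)+c)⁻² ≤ (s+c)⁻²`). [folklore] -/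
theorem integral_inv_add_sq_le {c S : ℝ} (hc : 0 < c) (hS : 0 ≤ S) :
    ∫ s in (0 : ℝ)..S, ((s + c) ^ 2)⁻¹ ≤ c⁻¹ := by
  have hzpow : ∀ u : ℝ, (u ^ 2)⁻¹ = u ^ (-2 : ℤ) := fun u => by
    rw [show (-2 : ℤ) = -((2 : ℕ) : ℤ) by norm_num, zpow_neg, zpow_natCast]
  rw [intervalIntegral.integral_comp_add_right (fun u : ℝ => (u ^ 2)⁻¹) c, zero_add]
  simp_rw [hzpow]
  have h0 : (0 : ℝ) ∉ Set.uIcc c (S + c) := by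
    rw [Set.uIcc_of_le (by linarith)]
    intro h
    exact absurd h.1 (not_le.2 hc)
  rw [integral_zpow (Or.inr ⟨by norm_num, h0⟩)]
  have e1 : (-2 : ℤ) + 1 = -((1 : ℕ) : ℤ) := by norm_num
  have h2 : (S + c) ^ ((-2 : ℤ) + 1) = (S + c)⁻¹ := by rw [e1, zpow_neg, zpow_natCast, pow_one]
  have h3 : c ^ ((-2 : ℤ) + 1) = c⁻¹ := by rw [e1, zpow_neg, zpow_natCast, pow_one]
  rw [h2, h3]
  have hpos : 0 ≤ (S + c)⁻¹ := by positivity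
  norm_num
  rw [div_neg, neg_le]
  have : (c⁻¹ - (S + c)⁻¹) / 1 ≤ c⁻¹ := by rw [div_one]; linarith
  linarith [this]

end Summit.QuantumFields.YangMills.Theorems.Prop7TorusGreenGradientBricks
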